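import Literature.InformationTheory.QuantumCodes.QuantumHammingCodes
import HarnessLib

/-!
# The syndrome decoder of the quantum Hamming codes `QH_r = ⟦2^r − 1, 2^r − 1 − 2r, 3⟧` (Steane's code for `r = 3`) as a
# computable FUNCTION, with certified radius `1` in both sectors, for every `r`

Topic `InformationTheory/QuantumCodes`; namespace `Literature.InformationTheory.QuantumCodes`. LADDER-QEC (cell `qec`),
PARTITION row 08 (decoders as functions; correction radius). The classical Hamming rule — «the syndrome, read as a binary
number, is the position of the error» — applied to each sector of the CSS code `QH_r` (`H_X = H_Z = H_r`,
`QuantumHammingCodes.lean`):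

* `HammingMatrix.syndromeDecode r : (Fin r → 𝔽₂) → (Fin (2^r − 1) → 𝔽₂)` — `0 ↦ 0`; a nonzero syndrome `s ↦` the unit
  vector at the column of `H_r` equal to `s` (column `i` of `H_r` is the binary expansion of `i + 1`, so the position is
  `(s read in base 2) − 1`); `syndromeDecode_col : syndromeDecode (col i) = 𝟙_i`, `syndromeDecode_mulVec_single`.
* `QuantumHamming.decodeX` / `decodeZ` = that function as the `X`- and the `Z`-sector decoder of `QH_r`;
  `decodeX_xSyndrome : |e| ≤ 1 → decodeX (xSyndrome e) = e` (route I: the correction IS the error), likewise `Z`;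
  `decodeX_correctsUpTo` / `decodeZ_correctsUpTo : CorrectsUpTo … 1`, and `decode_radius_optimal` (with
  `QuantumHamming.code_radius_optimal`: no pair of sector decoders corrects all weight-2 patterns) — the explicit decoders
  ATTAIN the optimal radius `1`, for every `r ≥ 3`.

Computable (a base-2 reading and one unit vector); 0 named facts, no `decide` on data, no instances/notation; axioms standard.
HONEST FRAMING: the textbook Hamming/Steane syndrome decoder, machine-checked for all `r`; no novelty.

References: [MacWilliamsSloane1977, Ch. 1 §7 (p0030: columns of H_r = all nonzero r-bit vectors; the syndrome locates the error)];
[Steane1996Simple, §3 (p0006 L46–58: single error correction of the [[2^r−1, 2^r−1−2r, 3]] codes)]; [NielsenChuang2010, §10.4.2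
(p. 450: CSS codes correct bit and phase flips with the classical decoders of C₁ and C₂⊥)].
-/

namespace Literature.InformationTheory.Coding.HammingMatrix

open Matrix Finset Literature.InformationTheory.QuantumCodes

variable (r : ℕ)

/-- Reading a syndrome as a binary number: `finFunctionFinEquiv`. For a column `col r i` the number is `i + 1`.
[cite: MacWilliamsSloane1977, Ch. 1 §7 (p0030)] -/
theorem finFunctionFinEquiv_col (i : Fin (2 ^ r - 1)) :
    finFunctionFinEquiv (m := 2) (n := r) (col r i) = ⟨i.val + 1, succ_lt_two_pow r i⟩ := by
  rw [col, Equiv.apply_symm_apply]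

/-- A nonzero syndrome reads as a nonzero number. [cite: MacWilliamsSloane1977, Ch. 1 §7 (p0030)] -/
theorem finFunctionFinEquiv_val_ne_zero {s : Fin r → ZMod 2} (hs : s ≠ 0) :
    (finFunctionFinEquiv (m := 2) (n := r) s).val ≠ 0 := by
  intro h0
  apply hs
  have h1 : finFunctionFinEquiv (m := 2) (n := r) s = ⟨0, Nat.two_pow_pos r⟩ := Fin.ext h0
  have h2 := congrArg (finFunctionFinEquiv (m := 2) (n := r)).symm h1
  rw [Equiv.symm_apply_apply, symm_zero] at h2
  exact h2

/-- **The Hamming syndrome decoder**: `0 ↦ 0`; a nonzero syndrome `s ↦` the single error at position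
`(s read in base 2) − 1`, i.e. at the column of `H_r` equal to `s`. Computable. (definition)
[cite: MacWilliamsSloane1977, Ch. 1 §7 (p0030: «the syndrome … tells us which digit is in error»)] -/
def syndromeDecode (s : Fin r → ZMod 2) : Fin (2 ^ r - 1) → ZMod 2 :=
  if hs : s = 0 then 0
  else Pi.single (⟨(finFunctionFinEquiv (m := 2) (n := r) s).val - 1, by
    have h1 := (finFunctionFinEquiv (m := 2) (n := r) s).isLt
    have h2 := finFunctionFinEquiv_val_ne_zero r hs
    omega⟩ : Fin (2 ^ r - 1)) 1

/-- The decoder is silent on the zero syndrome. [cite: MacWilliamsSloane1977, Ch. 1 §7 (p0030)] -/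
@[simp] theorem syndromeDecode_zero : syndromeDecode r 0 = 0 := by
  simp [syndromeDecode]

/-- **On the syndrome of a single error the decoder returns that error**: `syndromeDecode (col i) = 𝟙_i`.
[cite: MacWilliamsSloane1977, Ch. 1 §7 (p0030)] -/
theorem syndromeDecode_col (i : Fin (2 ^ r - 1)) : syndromeDecode r (col r i) = Pi.single i 1 := by
  unfold syndromeDecode
  rw [dif_neg (col_ne_zero r i)]
  congr 1
  apply Fin.ext
  simp [finFunctionFinEquiv_col]

/-- The same through the check matrix: `syndromeDecode (H_r 𝟙_i) = 𝟙_i`. [cite: MacWilliamsSloane1977, Ch. 1 §7 (p0030)] -/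
theorem syndromeDecode_mulVec_single (i : Fin (2 ^ r - 1)) :
    syndromeDecode r (hamMatrix r *ᵥ Pi.single i 1) = Pi.single i 1 := by
  rw [hamMatrix_mulVec_single, syndromeDecode_col]

end Literature.InformationTheory.Coding.HammingMatrix

namespace Literature.InformationTheory.QuantumCodes

open Matrix Finset Literature.InformationTheory.Coding Literature.InformationTheory.Coding.HammingMatrix

/-- A binary word of weight `≤ 1` is `0` or a unit vector. [cite: NielsenChuang2010, §10.4.2 (p. 450: single bit flips)] -/
theorem eq_zero_or_eq_single_of_hammingNorm_le_one {ι : Type*} [Fintype ι] [DecidableEq ι] {e : ι → ZMod 2}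
    (he : hammingNorm e ≤ 1) : e = 0 ∨ ∃ j, e = Pi.single j 1 := by
  classical
  by_cases h0 : e = 0
  · exact Or.inl h0
  right
  obtain ⟨j, hj⟩ : ∃ j, e j ≠ 0 := by
    by_contra hne
    push Not at hne
    exact h0 (funext hne)
  refine ⟨j, funext fun i => ?_⟩
  have hval : ∀ a : ZMod 2, a ≠ 0 → a = 1 := by decide
  by_cases hij : i = j
  · subst hij
    rw [Pi.single_eq_same]
    exact hval _ hj
  · rw [Pi.single_eq_of_ne hij]
    by_contra hi
    have h2 : 2 ≤ hammingNorm e := by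
      unfold hammingNorm
      have hsub : ({i, j} : Finset ι) ⊆ univ.filter fun l => e l ≠ 0 := by
        intro l hl
        rw [mem_insert, mem_singleton] at hl
        rw [mem_filter]
        rcases hl with rfl | rfl
        · exact ⟨mem_univ _, hi⟩
        · exact ⟨mem_univ _, hj⟩
      have := card_le_card hsub
      rwa [card_pair hij] at this
    omega

namespace QuantumHamming

variable {r : ℕ}

/-- **The bit-flip decoder of `QH_r`**: Hamming syndrome decoding of the `Z`-check syndrome `H_r e`. Computable. (definition)
[cite: Steane1996Simple, §3 (p0006 L46: «single error correction»)] [cite: NielsenChuang2010, §10.4.2 (p. 450)] -/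
def decodeX (r : ℕ) : Decoder (Fin r → ZMod 2) (Fin (2 ^ r - 1) → ZMod 2) := syndromeDecode r

/-- **The phase-flip decoder of `QH_r`**: the same function on the `X`-check syndrome. Computable. (definition)
[cite: Steane1996Simple, §3 (p0006 L46)] [cite: NielsenChuang2010, §10.4.2 (p. 450)] -/
def decodeZ (r : ℕ) : Decoder (Fin r → ZMod 2) (Fin (2 ^ r - 1) → ZMod 2) := syndromeDecode r

/-- **Route I, bit flips**: on every `X`-pattern of weight `≤ 1` the decoder returns the error itself.
[cite: Steane1996Simple, §3 (p0006 L46)] -/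
theorem decodeX_xSyndrome (hr : 3 ≤ r) {e : Fin (2 ^ r - 1) → ZMod 2} (he : hammingNorm e ≤ 1) :
    decodeX r ((code r hr).xSyndrome e) = e := by
  rw [CSSCode.xSyndrome_apply, code_HZ]
  rcases eq_zero_or_eq_single_of_hammingNorm_le_one he with rfl | ⟨j, rfl⟩
  · rw [Matrix.mulVec_zero]; exact syndromeDecode_zero r
  · exact syndromeDecode_mulVec_single r j

/-- **Route I, phase flips**: on every `Z`-pattern of weight `≤ 1` the decoder returns the error itself.
[cite: Steane1996Simple, §3 (p0006 L46)] -/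
theorem decodeZ_zSyndrome (hr : 3 ≤ r) {e : Fin (2 ^ r - 1) → ZMod 2} (he : hammingNorm e ≤ 1) :
    decodeZ r ((code r hr).zSyndrome e) = e := by
  unfold CSSCode.zSyndrome
  rw [code_HX]
  rcases eq_zero_or_eq_single_of_hammingNorm_le_one he with rfl | ⟨j, rfl⟩
  · rw [Matrix.mulVec_zero]; exact syndromeDecode_zero r
  · exact syndromeDecode_mulVec_single r j

/-- **The bit-flip decoder corrects every `X`-pattern of weight `≤ 1`.** [cite: Steane1996Simple, §3 (p0006 L46)] -/
theorem decodeX_correctsUpTo (hr : 3 ≤ r) :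
    (decodeX r).CorrectsUpTo (code r hr).xSyndrome ((code r hr).rowSpX : Set (Fin (2 ^ r - 1) → ZMod 2)) hammingNorm 1 := by
  intro e he
  show decodeX r ((code r hr).xSyndrome e) + e ∈ ((code r hr).rowSpX : Set (Fin (2 ^ r - 1) → ZMod 2))
  rw [decodeX_xSyndrome hr he]
  have : e + e = 0 := by funext q; exact CharTwo.add_self_eq_zero _
  rw [this]
  exact (code r hr).rowSpX.zero_mem

/-- **The phase-flip decoder corrects every `Z`-pattern of weight `≤ 1`.** [cite: Steane1996Simple, §3 (p0006 L46)] -/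
theorem decodeZ_correctsUpTo (hr : 3 ≤ r) :
    (decodeZ r).CorrectsUpTo (code r hr).zSyndrome ((code r hr).rowSpZ : Set (Fin (2 ^ r - 1) → ZMod 2)) hammingNorm 1 := by
  intro e he
  show decodeZ r ((code r hr).zSyndrome e) + e ∈ ((code r hr).rowSpZ : Set (Fin (2 ^ r - 1) → ZMod 2))
  rw [decodeZ_zSyndrome hr he]
  have : e + e = 0 := by funext q; exact CharTwo.add_self_eq_zero _
  rw [this]
  exact (code r hr).rowSpZ.zero_mem

/-- **The explicit syndrome decoders attain the optimal radius `1` of `QH_r`** (no pair of sector decoders corrects all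
weight-`2` patterns, `code_radius_optimal`). [cite: Steane1996Simple, §3 (p0006 L46: «single error correction, ie d = 3»)] -/
theorem decode_radius_optimal (hr : 3 ≤ r) :
    ((decodeX r).CorrectsUpTo (code r hr).xSyndrome ((code r hr).rowSpX : Set (Fin (2 ^ r - 1) → ZMod 2)) hammingNorm 1 ∧
      (decodeZ r).CorrectsUpTo (code r hr).zSyndrome ((code r hr).rowSpZ : Set (Fin (2 ^ r - 1) → ZMod 2)) hammingNorm 1) ∧
    ∀ t : ℕ, (decodeX r).CorrectsUpTo (code r hr).xSyndrome ((code r hr).rowSpX : Set (Fin (2 ^ r - 1) → ZMod 2)) hammingNorm t →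
      (decodeZ r).CorrectsUpTo (code r hr).zSyndrome ((code r hr).rowSpZ : Set (Fin (2 ^ r - 1) → ZMod 2)) hammingNorm t →
        t ≤ 1 :=
  ⟨⟨decodeX_correctsUpTo hr, decodeZ_correctsUpTo hr⟩, fun _ hX hZ => code_radius_optimal hr hX hZ⟩

/-- `r = 3`: the Steane code's syndrome decoders correct every single bit flip and every single phase flip.
[cite: Steane1996Simple, §3 (p0006 L55-58)] -/
theorem steane_decode_correctsUpTo :
    (decodeX 3).CorrectsUpTo (code 3 le_rfl).xSyndrome ((code 3 le_rfl).rowSpX : Set (Fin (2 ^ 3 - 1) → ZMod 2)) hammingNorm 1 ∧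
      (decodeZ 3).CorrectsUpTo (code 3 le_rfl).zSyndrome ((code 3 le_rfl).rowSpZ : Set (Fin (2 ^ 3 - 1) → ZMod 2)) hammingNorm 1 :=
  (decode_radius_optimal (r := 3) le_rfl).1

end QuantumHamming

/-! ## Appendix (qec-type-08 gen 6, «QH-PERFECT»): the quantum Hamming codes are sector-PERFECT -/

namespace QuantumHamming

/-- ★ **The quantum Hamming codes are PERFECT in each sector** (every `r ≥ 2`): every syndrome `s ∈ 𝔽₂^r` of the `Z`-checks
(and, by `H^X = H^Z`, of the `X`-checks) `H_r` is the syndrome of EXACTLY ONE error of weight `≤ 1` — `s = 0 ↔` no error,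
`s ≠ 0 ↔` the single error at the column of `H_r` equal to `s` («the columns of `H_r` are all nonzero binary vectors»). So the
syndrome-table decoder `syndromeDecode` is TOTAL and its table is a bijection (`2^r` syndromes ↔ `1 + (2^r − 1)` errors).
[cite: MacWilliamsSloane1977, Ch. 1 §7 (chunk p0030: the columns of H_r are all the nonzero r-bit vectors; "the syndrome … tells us which digit is in error"); Ch. 1 §5 Thm. 6 (p0028: Hamming codes are perfect)] -/
theorem decode_perfect (r : ℕ) (s : Fin r → ZMod 2) :
    ∃! e : Fin (2 ^ r - 1) → ZMod 2, hammingNorm e ≤ 1 ∧ hamMatrix r *ᵥ e = s := by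
  classical
  by_cases hs : s = 0
  · subst hs
    refine ⟨0, ⟨by simp, by rw [mulVec_zero]⟩, ?_⟩
    intro e ⟨he, hes⟩
    rcases eq_zero_or_eq_single_of_hammingNorm_le_one he with rfl | ⟨j, rfl⟩
    · rfl
    · rw [hamMatrix_mulVec_single] at hes
      exact absurd hes (col_ne_zero r j)
  · obtain ⟨i, hi⟩ := exists_col_eq r s hs
    refine ⟨Pi.single i 1, ⟨?_, by rw [hamMatrix_mulVec_single, hi]⟩, ?_⟩
    · unfold hammingNorm
      refine (Finset.card_le_one.2 fun a ha b hb => ?_)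
      rw [Finset.mem_filter] at ha hb
      by_contra hab
      rcases eq_or_ne a i with rfl | hai
      · exact hb.2 (by rw [Pi.single_eq_of_ne (Ne.symm hab)])
      · exact ha.2 (by rw [Pi.single_eq_of_ne hai])
    · intro e ⟨he, hes⟩
      rcases eq_zero_or_eq_single_of_hammingNorm_le_one he with rfl | ⟨j, rfl⟩
      · rw [mulVec_zero] at hes
        exact absurd hes.symm hs
      · rw [hamMatrix_mulVec_single, ← hi] at hes
        rw [col_injective r hes]

end QuantumHamming

end Literature.InformationTheory.QuantumCodes
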